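import Literature.MathematicalPhysics.QuantumLattice.SpinLiquid
import Literature.MathematicalPhysics.QuantumLattice.LatticeToriLROProofs
import HarnessLib

/-!
# Discharges for the spin-liquid working definition (`SpinLiquid`): no long-range order

Trunk QLatticeAQFT (item Q14 `SpinLiquid`), consumed by `hubbard.S03` / `hubbard.S24`.
Sibling proof file of `Literature/MathematicalPhysics/QuantumLattice/SpinLiquid.lean`: it
discharges named facts (`def X : Prop`, D-0014) of that file as `theorem X_holds : X`, from
Mathlib and the accepted prelude (`sum_halfOpenBox_comp_torusProj`, `card_halfOpenBox`,
`structureFactor_zero`, `localOp`, `pushOp`). No statement is introduced or changed here.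

Discharged:

* `Literature.QLattice.not_hasTorusLRO_of_hasNoLongRangeOrder_holds :
  not_hasTorusLRO_of_hasNoLongRangeOrder` — absence of long-range order in the sense of
  `HasNoLongRangeOrder ω O` (structure factor `S_L(k_L) → 0` along every sequence of ordering
  vectors; only `k = 0` is used) excludes long-range order in the outline-§0 sense
  `HasTorusLRO (orderParamCorrFamily ω O)` (`0 < liminf_L L^{-2d} Σ_{x y} re ⟨O_x ; O_y⟩`).
* `Literature.QLattice.IsSpinLiquid.not_hasTorusLRO_holds : IsSpinLiquid.not_hasTorusLRO` — a spin
  liquid (H21 working definition, clause (2): `∀ O, HasNoLongRangeOrder ω O`) has no long-range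
  order in the §0 sense for any local order parameter; immediate from the previous item.
* `isSupportedOn_pushOp_holds : isSupportedOn_pushOp` — an observable pushed forward along a site
  map `f : Λ₀ → Λ` (`pushOp f A`) is supported on `univ.image f`: it is literally `localOp` of the
  relabelled matrix on the image (Bratteli–Robinson II §6.2.1, local algebras and isotony).
* `isSupportedOn_orderParamAt_holds : isSupportedOn_orderParamAt` — the placed order parameter
  `O_x = orderParamAt O x` is supported on the translated decorated box
  `(proj_L (box d r) + x) × κ`; the instance of the previous item for the placement map.
* `torusTranslate_orderParamAt_holds : torusTranslate_orderParamAt` — translation covariance of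
  the placed order parameter, `τ_v O_x = O_{x+v}`: relabelling a pushed-forward observable along a
  site bijection `e` is pushing forward along the composed map (`reindexOp_pushOp`:
  `reindexOp e (pushOp f A) = pushOp (e ∘ f) A`, Bratteli–Robinson II §6.2.1, covariance), and
  `(proj_L b + x) + v = proj_L b + (x + v)`.

Auxiliary (private): `lroSeq_orderParamCorrFamily_succ` (at side `L + 1` the normalised double
sum of the §0 convention equals `re S_{L+1}(0)`); the reindexing lemma
`sum_halfOpenBox_comp_torusProj` (a sum over the fundamental domain `halfOpenBox d L = {0, …, L-1}^d`
of a function of `Torus.proj L x` is the sum over `(ℤ/Lℤ)^d`) is imported from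
`LatticeToriLROProofs` (formerly a private copy here).

## Proof

Take `k_L = 0` in `HasNoLongRangeOrder`: `‖S_{L+1}(0)‖ → 0`. By `structureFactor_zero`,
`S_{L+1}(0) = (L+1)^{-2d} Σ_{x, y ∈ (ℤ/(L+1)ℤ)^d} ⟨O_x ; O_y⟩`, whose real part is the `(L+1)`-st
term `a_{L+1}` of the sequence whose `liminf` defines `HasTorusLRO` (the double sum over
`halfOpenBox d (L+1)` is the torus double sum since `Torus.proj` is a bijection there, and
`#halfOpenBox d (L+1) = (L+1)^d`). Hence `|a_{L+1}| ≤ ‖S_{L+1}(0)‖ → 0`, so `a_L → 0` (an index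
shift does not affect the limit; the junk value `a_0` is irrelevant), `liminf_L a_L = 0`, and
`0 < liminf` fails.

## Sources

* L. Savary, L. Balents, *Quantum spin liquids: a review*, Rep. Prog. Phys. **80** (2017)
  016502 = arXiv:1601.03742 (held copy), §2 "What are quantum spin liquids?", PDF p. 3:
  "a QSL is a system of quantum spins which are highly correlated with one another due to
  their mutual interactions, yet do not order even at very low or zero temperature." In the
  H21 working definition this is clause (2) of `IsSpinLiquid`; the discharged implication is
  therefore definitional plus the elementary limit computation below.
* S. Friedli, Y. Velenik, *Statistical Mechanics of Lattice Systems*, CUP (2017) (held copy),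
  §3.7.1, Remark 3.33 and eq. (3.28), book p. 114 (PDF p. 120): "Such a behavior
  [`inf_i ⟨σ_0 σ_i⟩ > 0`] is referred to as long-range order"; the tree's `HasLongRangeOrder` /
  `HasTorusLRO` is the volume-averaged (`liminf` of normalised double sums) form of this notion.
* O. Bratteli, D. W. Robinson, *Operator Algebras and Quantum Statistical Mechanics 2*
  (2nd ed., Springer 1997), §6.2.1 "Kinematical and dynamical descriptions" (not held; the
  contents of Volume 2 printed in the held Volume 1, PDF p. 8, locate §6.2 "Quantum Spin
  Systems" / §6.2.1): the local algebras `𝔄_Λ = 𝓛(⨂_{x∈Λ} 𝔥_x)` and isotony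
  `𝔄_{Λ₁} ⊆ 𝔄_{Λ₂}`, `Λ₁ ⊆ Λ₂`, via `A ↦ A ⊗ 𝟙`; the two support discharges are the entrywise
  (definitional) form of this embedding for the tree's `localOp` / `pushOp`.
-/

noncomputable section

open Matrix Complex Finset Filter ZMod
open scoped Topology

namespace Literature.MathematicalPhysics.QuantumLattice

open Literature.Probability.LatticeModels

variable {d : ℕ} {κ : Type*} [Fintype κ] [DecidableEq κ] {q : ℕ}

/-- At side `L + 1` the normalised double sum of the §0 long-range-order convention for the
family `orderParamCorrFamily ω O` (pulled back to the fundamental domain `halfOpenBox`) is the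
real part of the structure factor at `k = 0`:
`|Λ|⁻² Σ_{x, y ∈ {0..L}^d} re ⟨O_x ; O_y⟩ = re S_{L+1}(0)` (`structureFactor_zero`,
`card_halfOpenBox`). Friedli–Velenik (2017), §3.7.1, Remark 3.33. [folklore] -/
private theorem lroSeq_orderParamCorrFamily_succ (ω : ∀ L, Op (TorusSite d L × κ) q →ₗ[ℂ] ℂ)
    (O : LocalOrderParameter d κ q) (L : ℕ) :
    (∑ x ∈ halfOpenBox d (L + 1), ∑ y ∈ halfOpenBox d (L + 1),
        torusPullback (orderParamCorrFamily ω O) (L + 1) x y) /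
      (#(halfOpenBox d (L + 1)) : ℝ) ^ 2 =
    (structureFactor (ω (L + 1)) O 0).re := by
  have h1 : ∑ x ∈ halfOpenBox d (L + 1), ∑ y ∈ halfOpenBox d (L + 1),
      torusPullback (orderParamCorrFamily ω O) (L + 1) x y =
      ∑ x : TorusSite d (L + 1), ∑ y : TorusSite d (L + 1),
        (connectedCorr (ω (L + 1)) O x y).re := by
    simp only [torusPullback_apply]
    rw [sum_halfOpenBox_comp_torusProj (fun t => ∑ y ∈ halfOpenBox d (L + 1),
      orderParamCorrFamily ω O (L + 1) t (Torus.proj (L + 1) y))]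
    exact Finset.sum_congr rfl fun t _ =>
      sum_halfOpenBox_comp_torusProj (fun s => orderParamCorrFamily ω O (L + 1) t s)
  have h2 : (((L + 1 : ℕ) : ℂ) ^ d) ^ 2 = ((((L + 1) ^ d) ^ 2 : ℕ) : ℂ) := by push_cast; ring
  rw [h1, structureFactor_zero, card_halfOpenBox, h2, Complex.div_natCast_re]
  simp only [Complex.re_sum]
  push_cast
  ring

/-- **Discharge of `not_hasTorusLRO_of_hasNoLongRangeOrder`.** Absence of long-range order in
the sense of `HasNoLongRangeOrder` (used at the ordering vector `k = 0` only) excludes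
long-range order in the §0 sense `HasTorusLRO` for the family `orderParamCorrFamily ω O`:
at side `L + 1` the normalised double sum `|Λ|⁻² Σ_{x y} re ⟨O_x ; O_y⟩` is `re S_{L+1}(0)`
(`lroSeq_orderParamCorrFamily_succ`), `|re S| ≤ ‖S‖ → 0`, so the whole sequence tends to `0`
(`Filter.tendsto_add_atTop_iff_nat`; the junk value at `L = 0` is irrelevant), its `liminf`
is `0`, and `0 < liminf` fails. Friedli–Velenik (2017), §3.7.1, Remark 3.33 / eq. (3.28)
(long-range order), of which `HasTorusLRO` is the volume-averaged form; Savary–Balents (2017),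
§3.1. [cite: FriedliVelenik2017, §3.7.1 Remark 3.33] -/
theorem not_hasTorusLRO_of_hasNoLongRangeOrder_holds :
    not_hasTorusLRO_of_hasNoLongRangeOrder (d := d) (κ := κ) (q := q) := by
  intro ω O h hLRO
  -- the normalised double sums of the LRO convention
  set a : ℕ → ℝ := fun L =>
    (∑ x ∈ halfOpenBox d L, ∑ y ∈ halfOpenBox d L,
        torusPullback (orderParamCorrFamily ω O) L x y) / (#(halfOpenBox d L) : ℝ) ^ 2 with ha
  have hT : Tendsto a atTop (𝓝 0) := by
    rw [← tendsto_add_atTop_iff_nat 1]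
    refine squeeze_zero_norm (fun L => ?_) (h fun _ => 0)
    rw [Real.norm_eq_abs, ha]
    dsimp only
    rw [lroSeq_orderParamCorrFamily_succ]
    exact Complex.abs_re_le_norm _
  change 0 < liminf a atTop at hLRO
  rw [hT.liminf_eq] at hLRO
  exact lt_irrefl 0 hLRO

/-- **Discharge of `IsSpinLiquid.not_hasTorusLRO`.** A spin liquid in the sense of the H21
working definition has, by its clause (2) (`HasNoLongRangeOrder` for every local order
parameter) and `not_hasTorusLRO_of_hasNoLongRangeOrder_holds`, no long-range order in the §0
sense `HasTorusLRO` for any local order parameter. Savary–Balents (2017), §2, PDF p. 3 ("a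
system of quantum spins which ... do not order even at very low or zero temperature"); the
implication itself is definitional in the working definition. [cite: SavaryBalents2017, §2] -/
theorem IsSpinLiquid.not_hasTorusLRO_holds : IsSpinLiquid.not_hasTorusLRO (d := d) (κ := κ) := by
  intro n ω H h O
  exact not_hasTorusLRO_of_hasNoLongRangeOrder_holds (h.2.1 O)

/-! ### Supports of pushed-forward observables and of placed order parameters -/

section Push

variable {Λ₀ Λ : Type*} [Fintype Λ₀] [DecidableEq Λ]

/-- **Discharge of `isSupportedOn_pushOp`.** A pushed-forward observable `pushOp f A`
(`f : Λ₀ → Λ`, `A ∈ 𝔄_{Λ₀}`) is supported on the image `f(Λ₀)`: it *is* `localOp (univ.image f) B`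
for the matrix `B σ τ = A (σ ∘ f) (τ ∘ f)` on configurations of the region `univ.image f`
(definitional, up to the decidability instance of the off-image condition; same argument as
`isSupportedOn_wrapTerm` in `LocalDynamics`). Bratteli–Robinson, *Operator Algebras and Quantum
Statistical Mechanics 2*, §6.2.1 "Kinematical and dynamical descriptions": the local algebras
`𝔄_Λ = 𝓛(𝔥_Λ)`, `𝔥_Λ = ⨂_{x ∈ Λ} 𝔥_x`, with `𝔄_{Λ₁} ≅ 𝔄_{Λ₁} ⊗ 𝟙_{Λ₂∖Λ₁} ⊆ 𝔄_{Λ₂}` for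
`Λ₁ ⊆ Λ₂` (isotony), of which this is the relabelled instance along `f`.
[cite: BratteliRobinsonII1997, §6.2.1] -/
theorem isSupportedOn_pushOp_holds : isSupportedOn_pushOp (Λ₀ := Λ₀) (Λ := Λ) (q := q) := by
  intro _ f A
  classical
  refine ⟨fun σ τ => A (fun x => σ ⟨f x, mem_image_of_mem f (mem_univ x)⟩)
    (fun x => τ ⟨f x, mem_image_of_mem f (mem_univ x)⟩), ?_⟩
  ext σ τ
  simp only [localOp, pushOp, of_apply]
  split_ifs <;> rfl

end Push

/-- **Discharge of `isSupportedOn_orderParamAt`.** The placed order parameter `O_x`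
(`orderParamAt O x`, i.e. `O.op` pushed forward along the placement map
`(b, k) ↦ (proj_L b + x, k)` of the decorated box into the decorated torus) is supported on the
image of that map, the translated decorated box `(proj_L (box d r) + x) × κ`: immediate from
`isSupportedOn_pushOp_holds`. Bratteli–Robinson II, §6.2.1 (local algebras `𝔄_Λ`, isotony and
covariance under lattice translations); Savary–Balents (2017) §3.1 for the placed order
parameter. [cite: BratteliRobinsonII1997, §6.2.1] -/
theorem isSupportedOn_orderParamAt_holds :
    isSupportedOn_orderParamAt (d := d) (κ := κ) (q := q) := by
  intro L _ O x
  exact isSupportedOn_pushOp_holds _ _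

/-! ### Translation covariance of pushed-forward observables and of placed order parameters -/

section PushReindex

variable {Λ₀ Λ Λ' : Type*} [Fintype Λ₀] [Fintype Λ] [DecidableEq Λ] [Fintype Λ'] [DecidableEq Λ']

/-- **Relabelling a pushed-forward observable** along a site bijection `e : Λ ≃ Λ'` is pushing
forward along the composed site map: `reindexOp e (pushOp f A) = pushOp (e ∘ f) A` (entrywise:
both sides read `A (σ ∘ e ∘ f) (τ ∘ e ∘ f)` when `σ = τ` off the image, else `0`; the off-image
conditions correspond under `e`). Bratteli–Robinson II §6.2.1 (covariance of the local algebras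
under lattice symmetries, `τ_e(𝔄_X) = 𝔄_{e(X)}`). [cite: BratteliRobinsonII1997, §6.2.1] -/
theorem reindexOp_pushOp (e : Λ ≃ Λ') (f : Λ₀ → Λ) (A : Op Λ₀ q) :
    reindexOp e (pushOp f A) = pushOp (e ∘ f) A := by
  classical
  ext σ τ
  -- `reindexOp e B σ τ = B (σ ∘ e) (τ ∘ e)` definitionally (`Matrix.reindexAlgEquiv`)
  change pushOp f A (fun x => σ (e x)) (fun x => τ (e x)) = _
  simp only [pushOp, of_apply]
  have himg : ∀ y : Λ, e y ∈ univ.image (e ∘ f) ↔ y ∈ univ.image f := fun y => by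
    simp only [mem_image, mem_univ, true_and, Function.comp_apply, e.apply_eq_iff_eq]
  have h : (∀ y : Λ, y ∉ univ.image f → σ (e y) = τ (e y)) ↔
      ∀ y' : Λ', y' ∉ univ.image (e ∘ f) → σ y' = τ y' := by
    constructor
    · intro h y' hy'
      have h1 := h (e.symm y') fun hm => hy' (by rwa [← himg, e.apply_symm_apply] at hm)
      rwa [e.apply_symm_apply] at h1
    · intro h y hy
      exact h (e y) fun hm => hy ((himg y).1 hm)
  split_ifs <;> first | rfl | (exfalso; tauto)

end PushReindex

/-- **Discharge of `torusTranslate_orderParamAt`** (translation covariance of the placed order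
parameter): `τ_v O_x = O_{x+v}` for every local order parameter `O`, every torus side `L` and all
`v, x ∈ (ℤ/Lℤ)^d`. `τ_v = reindexOp` along `(y, k) ↦ (y + v, k)` and `O_x = pushOp` of `O.op`
along `(b, k) ↦ (proj_L b + x, k)`; by `reindexOp_pushOp` the left side is the push-forward along
`(b, k) ↦ ((proj_L b + x) + v, k) = (proj_L b + (x + v), k)`. Bratteli–Robinson II §6.2.1
(covariance); Savary–Balents (2017) §3.1 (placed order parameters). [cite: BratteliRobinsonII1997, §6.2.1] -/
theorem torusTranslate_orderParamAt_holds :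
    torusTranslate_orderParamAt (d := d) (κ := κ) (q := q) := by
  intro L _ O v x
  unfold torusTranslate orderParamAt
  rw [reindexOp_pushOp]
  congr 1
  funext p
  simp only [Function.comp_apply, Equiv.prodCongr_apply, Prod.map, Equiv.coe_addRight,
    Equiv.coe_refl, id, add_assoc]

end Literature.MathematicalPhysics.QuantumLattice
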